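import Summits.NavierStokesRegularity.NavierStokesRegularity.Theses.AxisymmetricExtremality
import Summits.NavierStokesRegularity.NavierStokesRegularity.Theorems.AxisymmetricExtremalityAxisymmetricKatoGlobalStubSereginLogSwirlOriginStep4AssemblyParts
import Summits.NavierStokesRegularity.NavierStokesRegularity.Theorems.AxisymmetricExtremalityAxisymmetricKatoGlobalStubSereginLogSwirlOriginStep4Endgame
import Literature.Analysis.FluidPDE.AxisymGradientField
import HarnessLib

/-!
# Seregin 2022, §2 Step 4 (assembly, IV): the Step-3 bounds imply `C(R) ≤ C R^{3/2}` and
# `C(R) → 0` — crux stmt-NavierStokesRegularity-15453 (`AxisymmetricExtremality.AxisymmetricKatoGlobal`), line registered, support for stub `stub_sereginLogSwirlOrigin`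

Support file (`--supports stmt-NavierStokesRegularity-15453`; theorems only, everything proved)
toward the registered stub `stub_sereginLogSwirlOrigin` = the named fact
`Literature.Analysis.FluidPDE.seregin2022_logSwirl_regularAtOrigin` (G. Seregin, J. Math. Fluid
Mech. 24 (2022), Paper 27 = arXiv:2201.00153, §2).  Step 4 ("Final Conclusion", arXiv p. 7)
starts from the Step-3 estimate `sup_{-1<t<0}∫_𝒞 η⁶(|Γ|² + |Φ|²) + ∫_Q (η³|∇Φ|)² + (η³|∇Γ|)² ≤
C(v, η, r₁)`, "re-written to the form (2.7) `|η³Φ|²_{2,Q} + |η³Γ|²_{2,Q} < ∞`", and shows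
`C(R) = R⁻²∫_{Q(R)}|v|³ → 0` as `R → 0` ((2.8) for `v̄`, the `v_θ` passage for the swirl),
whence "according to the partial regularity theory … the origin `z = 0` is a regular point of `v`"
(landed: `isRegularAtOrigin_of_tendsto_cubicC`, `…Step4Endgame.lean`).  This file assembles the
implication **Step-3 bounds ⇒ `C(R) → 0`** in the honest classical-on-a-slab form to which Step 1
reduces the suitable weak case: on a final time slab `]t₁, 0[` the slices `v t` are axisymmetric
`C⁴` fields on `ℝ³`, divergence free on an open `U`; `ζ = η³` is a `C²` (time-independent: `ξ = 1`
for `t ≥ -1/64`) cut-off with `tsupport ζ ⊆ U ∩ 𝒞` and `ζ = 1` on `𝒞(r₁)`; `v` is in the energy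
class `sup_t ∫_𝒞 |v|² ≤ A` and bounded on `supp ∇ζ` (Step 1: `v`, `∇v`, `∇²v`, `∇ω` are bounded
on `supp ∇η`).  Proved:

* `tendsto_cubicC_of_le_rpow` — a rate `C(R) ≤ C R^γ`, `γ > 0`, on `]0, R₀]` gives `C(R) → 0`;
* `cubicC_le_of_twoSeven` (registered) — **from (2.7)** (`sup_t ‖ζΓ‖₂² ≤ K_Γ`, `sup_t ‖ζΦ‖₂² ≤ K_Φ`,
  `‖∇(ζΦ)‖²_{2,]t₁,0[×ℝ³} ≤ K_Φ'`; the gradient of `ζΓ` is not needed):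
  `C(R) ≤ C R^{3/2}` for `0 < R ≤ min(r₁, √|t₁|)` (`SereginSverak2009.cubicC`, coordinate cylinders);
* `tendsto_cubicC_of_twoSeven` (registered) — hence `C(R) → 0` as `R → 0⁺`;
* `cubicC_le_of_step3Bounds`, `tendsto_cubicC_of_step3Bounds` (registered) — the same **from the
  printed Step-3 output** `sup_t ∫ζ²(Γ² + Φ²) ≤ K`, `∫_{t₁}^0∫ζ²(‖∇Φ‖² + ‖∇Γ‖²) ≤ K` (time integral
  iterated, `η⁶ = ζ²`) plus `|Φ| ≤ L` on `supp ∇ζ`, through the rewriting to (2.7)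
  (`lintegral_enorm_fderiv_mul_radVelQuot_sq_le`, `…Step4AssemblySwirl.lean`);
* `isRegularAtOrigin_of_step3Bounds` — glued to the landed endgame: Def. 1.1 class on `Q` + the
  slab hypotheses ⇒ `SereginSverak2009.IsRegularAtOrigin v`;
* `norm_fderiv_sq_eq_sum_sq` — `‖D f x‖² = Σᵢ(∂ᵢf)²` for scalar `f`, the bridge to the coordinate
  form of `‖∇(ζG)‖²` used by the Step-3 files (`…Step3Gamma`, `…Step3Balance`).

Rates: poloidal `R^{3/2}` (`Ḣ¹ ⊂ L⁶` at fixed time; any positive rate suffices), swirl `R^{12/5}`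
(= printed `(10/3 + 1)·9/10 − 3/2`).

## References

* G. Seregin, J. Math. Fluid Mech. 24 (2022), Paper No. 27 = arXiv:2201.00153, §2 Step 4 (arXiv
  p. 7), Step 3 (last display, p. 7), Step 1 (p. 5). [`Seregin2022LocalAxisym`]
-/

noncomputable section

open Set MeasureTheory Filter Topology Function Metric
open scoped ENNReal NNReal RealInnerProductSpace
open Literature.Analysis.FluidPDE

-- `<Problem> = <Summit>` duplicates a namespace component by design (lakefile sets the same option).
set_option linter.dupNamespace false

namespace Summit.NavierStokesRegularity.NavierStokesRegularity.Theorems.AxisymmetricKatoGlobal.EulerScaling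

/-! ### Step 4: `C(R) ≤ C R^{3/2}` for small `R`, and `C(R) → 0` -/

section Main

/-- **Rate to limit**: `C(R) ≤ C R^γ` on `]0, R₀]` with `γ > 0` gives `C(R) → 0` as `R → 0⁺`. [folklore] -/
theorem tendsto_cubicC_of_le_rpow {v : ℝ → EuclideanSpace ℝ (Fin 3) → EuclideanSpace ℝ (Fin 3)}
    {C : ℝ≥0} {R₀ γ : ℝ} (hR₀ : 0 < R₀) (hγ : 0 < γ)
    (h : ∀ R ∈ Ioc 0 R₀, SereginSverak2009.cubicC 0 R v ≤ C * ENNReal.ofReal R ^ γ) :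
    Tendsto (fun R => SereginSverak2009.cubicC 0 R v) (𝓝[>] 0) (𝓝 0) := by
  have h0 : Tendsto (fun R : ℝ => R) (𝓝[>] (0 : ℝ)) (𝓝 0) :=
    tendsto_nhdsWithin_of_tendsto_nhds tendsto_id
  have h1 : Tendsto (fun R : ℝ => ENNReal.ofReal R) (𝓝[>] (0 : ℝ)) (𝓝 0) := by
    have := ENNReal.tendsto_ofReal h0
    rwa [ENNReal.ofReal_zero] at this
  have h2 : Tendsto (fun R : ℝ => ENNReal.ofReal R ^ γ) (𝓝[>] (0 : ℝ)) (𝓝 0) := by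
    have hc : Tendsto (fun a : ℝ≥0∞ => a ^ γ) (𝓝 0) (𝓝 ((0 : ℝ≥0∞) ^ γ)) :=
      (ENNReal.continuous_rpow_const (y := γ)).tendsto 0
    rw [ENNReal.zero_rpow_of_pos hγ] at hc
    exact hc.comp h1
  have h3 : Tendsto (fun R : ℝ => (C : ℝ≥0∞) * ENNReal.ofReal R ^ γ) (𝓝[>] (0 : ℝ)) (𝓝 0) := by
    simpa using ENNReal.Tendsto.const_mul h2 (Or.inr ENNReal.coe_ne_top)
  refine tendsto_of_tendsto_of_tendsto_of_le_of_le' tendsto_const_nhds h3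
    (Eventually.of_forall fun R => bot_le) ?_
  filter_upwards [Ioc_mem_nhdsGT hR₀] with R hR using h R hR

/-- **Seregin 2022, §2 Step 4, from (2.7): `C(R) ≤ C R^{3/2}` for `0 < R ≤ min(r₁, √|t₁|)`.**
Classical-on-a-slab form of Step 4 (arXiv p. 7): the slices `v t`, `t ∈ ]t₁, 0[`, are axisymmetric
`C⁴` fields on `ℝ³`, divergence free on an open `U`; `ζ` (`= η³`) is a `C²` cut-off with
`tsupport ζ ⊆ U ∩ 𝒞`, `ζ = 1` on `𝒞(r₁)`; the hypotheses are the energy class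
`sup_t ∫_𝒞 |v|² ≤ A`, boundedness `|v| ≤ L` on `supp ∇ζ` (Step 1: `v` is smooth on `supp ∇η`), and
(2.7) `|η³Φ|²_{2,Q} + |η³Γ|²_{2,Q} < ∞` in the form `sup_t ‖ζΓ‖₂² ≤ K_Γ`, `sup_t ‖ζΦ‖₂² ≤ K_Φ`,
`‖∇(ζΦ)‖²_{2,]t₁,0[×ℝ³} ≤ K_Φ'` (`Γ = angVortQuot = ω_θ/r`, `Φ = radVelQuot ∘ curl = ω_r/r`; the
gradient of `ζΓ` is not needed).  Conclusion: the scaled functional `C(R) = R⁻²∫_{Q(R)}|v|³`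
(`SereginSverak2009.cubicC 0 R v`) is `≤ C R^{3/2}`: poloidal part by the first elliptic bound and
`Ḣ¹ ⊂ L⁶` (`setLIntegral_parCyl_enorm_poloidal_pow_three_le`, rate `R^{3/2}`), swirl part by the
`v_θ` passage (`setLIntegral_parCyl_enorm_swirlVelocity_pow_three_le`, rate `R^{12/5}`), joined by
`|v|³ ≤ 4(|v̄|³ + |v_θ|³)`. [cite: Seregin2022LocalAxisym, §2 Step 4 (arXiv:2201.00153 p. 7), (2.7)–(2.8) and the `v_θ` passage] -/
theorem cubicC_le_of_twoSeven : ∀ (v : ℝ → EuclideanSpace ℝ (Fin 3) → EuclideanSpace ℝ (Fin 3)) (ζ : EuclideanSpace ℝ (Fin 3) → ℝ) (U : Set (EuclideanSpace ℝ (Fin 3))) (t₁ r₁ L : ℝ) (A KΓ KΦ KΦ' : ℝ≥0), t₁ < 0 → 0 < r₁ → r₁ ≤ 1 → AEStronglyMeasurable (uncurry v) (volume.restrict (SereginSverak2009.parCyl 0 r₁)) → (∀ t ∈ Ioo t₁ 0, ContDiff ℝ 4 (v t)) → (∀ t ∈ Ioo t₁ 0, IsAxisymmetric (v t)) → IsOpen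 U → (∀ t ∈ Ioo t₁ 0, ∀ x ∈ U, VectorCalculus.divergence (v t) x = 0) → ContDiff ℝ 2 ζ → tsupport ζ ⊆ U → tsupport ζ ⊆ SereginSverak2009.spaceCyl 0 1 → (∀ x ∈ SereginSverak2009.spaceCyl 0 r₁, ζ x = 1) → (∀ t ∈ Ioo t₁ 0, ∫⁻ x in SereginSverak2009.spaceCyl 0 1, ‖v t x‖ₑ ^ 2 ≤ A) → (∀ t ∈ Ioo t₁ 0, ∀ x, fderiv ℝ ζ x ≠ 0 → ‖v t x‖ ≤ L) → (∀ t ∈ Ioo t₁ 0, ∫⁻ x, ‖ζ x * angVortQuot (v t) x‖ₑ ^ 2 ≤ KΓ) → (∀ t ∈ Ioo t₁ 0, ∫⁻ x, ‖ζ x * radVelQuot (curl (v t)) x‖ₑ ^ 2 ≤ KΦ) → (∫⁻ t in Ioo t₁ 0, ∫⁻ x, ‖fderiv ℝ (fun y => ζ y * radVelQuot (curl (v t)) y) x‖ₑ ^ 2 ≤ KΦ') → ∃ C : ℝ≥0, ∀ R ∈ Ioc 0 (min r₁ (Real.sqrt (-t₁))), SereginSverak2009.cubicC 0 R v ≤ C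 * ENNReal.ofReal R ^ (3 / 2 : ℝ) := by
  intro v ζ U t₁ r₁ L A KΓ KΦ KΦ' ht₁ hr₁ hr₁1 hmeas hv hax hU hdiv hζ hζU hζ1 hζr₁ hA hLv hΓ hΦ hΦ'
  -- the gradient bound of the cut-off
  have hζc : HasCompactSupport ζ := hasCompactSupport_of_tsupport_subset_spaceCyl hζ1
  obtain ⟨Cζ, hCζ⟩ :=
    (hζ.continuous_fderiv (by norm_num)).bounded_above_of_compact_support (hζc.fderiv ℝ)
  -- `(2.7)` ⇒ the space–time `L^{10/3}` bound of `ζΦ`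
  have hΦ1 : ∀ t ∈ Ioo t₁ 0, ContDiff ℝ 1 (radVelQuot (curl (v t))) := fun t ht =>
    contDiff_radVelQuot (n := 1)
      (by exact_mod_cast (contDiff_curl_of_succ (n := 3) (by exact_mod_cast hv t ht)))
  have hM := lintegral_lintegral_enorm_mul_rpow_tenThirds_le' (Φ := fun t => radVelQuot (curl (v t)))
    (hζ.of_le (by norm_num)) hζc hΦ1 hΦ hΦ'
  -- constants
  set CS : ℝ≥0∞ := (eLpNormLESNormFDerivOfEqInnerConst
    (volume : Measure (EuclideanSpace ℝ (Fin 3))) 2 : ℝ≥0∞) with hCS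
  set M : ℝ≥0∞ := (KΦ : ℝ≥0∞) ^ (2 / 3 : ℝ) * (CS ^ (2 : ℝ) * KΦ') with hMdef
  set V₃ : ℝ≥0∞ := volume (ball (0 : EuclideanSpace ℝ (Fin 3)) 1) with hV₃def
  set V₂ : ℝ≥0∞ := volume (ball (0 : EuclideanSpace ℝ (Fin 2)) 1) with hV₂def
  set Cpol : ℝ≥0∞ := (8 * V₃) ^ (1 / 2 : ℝ) *
    (CS ^ (6 : ℝ) * (2 * KΓ + 12 * ENNReal.ofReal (Cζ ^ 2) * A) ^ (3 : ℝ)) ^ (1 / 2 : ℝ) with hCpol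
  set Csw : ℝ≥0∞ := (8 * V₃) ^ (1 / 10 : ℝ) * (2 ^ (17 / 3 : ℝ) *
    (M + (ENNReal.ofReal Cζ * ENNReal.ofReal L) ^ (10 / 3 : ℝ) * (2 * V₂))) ^ (9 / 10 : ℝ) with hCsw
  have hV₃ : V₃ ≠ ∞ := measure_ball_lt_top.ne
  have hV₂ : V₂ ≠ ∞ := measure_ball_lt_top.ne
  have hCSt : CS ≠ ∞ := ENNReal.coe_ne_top
  have hMt : M ≠ ∞ :=
    ENNReal.mul_ne_top (ENNReal.rpow_ne_top_of_nonneg (by norm_num) ENNReal.coe_ne_top)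
      (ENNReal.mul_ne_top (ENNReal.rpow_ne_top_of_nonneg (by norm_num) hCSt) ENNReal.coe_ne_top)
  have hpolt : Cpol ≠ ∞ := by
    refine ENNReal.mul_ne_top (ENNReal.rpow_ne_top_of_nonneg (by norm_num)
      (ENNReal.mul_ne_top ENNReal.ofNat_ne_top hV₃)) (ENNReal.rpow_ne_top_of_nonneg (by norm_num)
      (ENNReal.mul_ne_top (ENNReal.rpow_ne_top_of_nonneg (by norm_num) hCSt)
        (ENNReal.rpow_ne_top_of_nonneg (by norm_num) (ENNReal.add_ne_top.2 ⟨?_, ?_⟩))))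
    · exact ENNReal.mul_ne_top ENNReal.ofNat_ne_top ENNReal.coe_ne_top
    · exact ENNReal.mul_ne_top (ENNReal.mul_ne_top ENNReal.ofNat_ne_top ENNReal.ofReal_ne_top)
        ENNReal.coe_ne_top
  have hswt : Csw ≠ ∞ := by
    refine ENNReal.mul_ne_top (ENNReal.rpow_ne_top_of_nonneg (by norm_num)
      (ENNReal.mul_ne_top ENNReal.ofNat_ne_top hV₃)) (ENNReal.rpow_ne_top_of_nonneg (by norm_num)
      (ENNReal.mul_ne_top (ENNReal.rpow_ne_top_of_nonneg (by norm_num) ENNReal.ofNat_ne_top)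
        (ENNReal.add_ne_top.2 ⟨hMt, ?_⟩)))
    exact ENNReal.mul_ne_top (ENNReal.rpow_ne_top_of_nonneg (by norm_num)
      (ENNReal.mul_ne_top ENNReal.ofReal_ne_top ENNReal.ofReal_ne_top))
      (ENNReal.mul_ne_top ENNReal.ofNat_ne_top hV₂)
  have hfin : 4 * (Cpol + Csw) ≠ ∞ :=
    ENNReal.mul_ne_top ENNReal.ofNat_ne_top (ENNReal.add_ne_top.2 ⟨hpolt, hswt⟩)
  refine ⟨(4 * (Cpol + Csw)).toNNReal, fun R hR => ?_⟩
  rw [ENNReal.coe_toNNReal hfin]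
  obtain ⟨hR0, hRle⟩ := hR
  have hRr₁ : R ≤ r₁ := hRle.trans (min_le_left _ _)
  have hR1 : R ≤ 1 := hRr₁.trans hr₁1
  have hRt : t₁ ≤ -R ^ 2 := by
    have h1 : R ≤ Real.sqrt (-t₁) := hRle.trans (min_le_right _ _)
    have h2 : R ^ 2 ≤ Real.sqrt (-t₁) ^ 2 := pow_le_pow_left₀ hR0.le h1 2
    rw [Real.sq_sqrt (by linarith)] at h2
    linarith
  set ρ : ℝ≥0∞ := ENNReal.ofReal R with hρ
  have hρ0 : ρ ≠ 0 := (ENNReal.ofReal_pos.2 hR0).ne'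
  have hρt : ρ ≠ ∞ := ENNReal.ofReal_ne_top
  have hρ1 : ρ ≤ 1 := ENNReal.ofReal_le_one.2 hR1
  -- the two parts on `Q(R)`
  have hpolQ : ∫⁻ z in SereginSverak2009.parCyl 0 R,
      ‖v z.1 z.2 - angVelQuot (v z.1) z.2 • rotGen z.2‖ₑ ^ (3 : ℕ) ≤ Cpol * ρ ^ (7 / 2 : ℝ) :=
    setLIntegral_parCyl_enorm_poloidal_pow_three_le' hv hax hζ hU hζU hζ1 hdiv hCζ hΓ hA hζr₁ hR0
      hRr₁ hRt
  have hswQ : ∫⁻ z in SereginSverak2009.parCyl 0 R, ‖swirlVelocity (v z.1) z.2‖ₑ ^ (3 : ℕ) ≤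
      Csw * ρ ^ (22 / 5 : ℝ) :=
    setLIntegral_parCyl_enorm_swirlVelocity_pow_three_le' hmeas
      (fun t ht => (hv t ht).of_le (by norm_num)) hax (hζ.of_le (by norm_num)) hζ1 hCζ hLv hM
      hζr₁ hR0 hRr₁ hR1 hRt
  -- splitting `|v|³ ≤ 4(|v̄|³ + |v_θ|³)` on `Q(R)`
  have hsubt : ∀ z ∈ SereginSverak2009.parCyl (0 : ℝ × EuclideanSpace ℝ (Fin 3)) R, z.1 ∈ Ioo t₁ 0 :=
    fun z hz => by
      have h := (SereginSverak2009.mem_parCyl_zero.1 hz).1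
      exact ⟨lt_of_le_of_lt hRt h.1, h.2⟩
  have hθm : AEMeasurable (fun z : ℝ × EuclideanSpace ℝ (Fin 3) =>
      ‖swirlVelocity (v z.1) z.2‖ₑ ^ (3 : ℕ)) (volume.restrict (SereginSverak2009.parCyl 0 R)) :=
    (aemeasurable_swirlVelocity_uncurry (hmeas.mono_measure (Measure.restrict_mono
      (SereginSverak2009.parCyl_mono 0 hR0.le hRr₁) le_rfl))).enorm.pow_const _
  have hI : ∫⁻ z in SereginSverak2009.parCyl 0 R, ‖v z.1 z.2‖ₑ ^ (3 : ℕ) ≤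
      4 * (Cpol * ρ ^ (7 / 2 : ℝ) + Csw * ρ ^ (7 / 2 : ℝ)) := by
    calc ∫⁻ z in SereginSverak2009.parCyl 0 R, ‖v z.1 z.2‖ₑ ^ (3 : ℕ)
        ≤ ∫⁻ z in SereginSverak2009.parCyl 0 R,
            4 * (‖v z.1 z.2 - angVelQuot (v z.1) z.2 • rotGen z.2‖ₑ ^ (3 : ℕ) +
              ‖swirlVelocity (v z.1) z.2‖ₑ ^ (3 : ℕ)) :=
          setLIntegral_mono' (SereginSverak2009.isOpen_parCyl 0 R).measurableSet fun z hz =>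
            enorm_pow_three_le_poloidal_add_swirl (hax z.1 (hsubt z hz))
              ((hv z.1 (hsubt z hz)).of_le (by norm_num)) z.2
      _ = 4 * ((∫⁻ z in SereginSverak2009.parCyl 0 R,
            ‖v z.1 z.2 - angVelQuot (v z.1) z.2 • rotGen z.2‖ₑ ^ (3 : ℕ)) +
            ∫⁻ z in SereginSverak2009.parCyl 0 R, ‖swirlVelocity (v z.1) z.2‖ₑ ^ (3 : ℕ)) := by
          rw [lintegral_const_mul' _ _ ENNReal.ofNat_ne_top, lintegral_add_right' _ hθm]
      _ ≤ 4 * (Cpol * ρ ^ (7 / 2 : ℝ) + Csw * ρ ^ (22 / 5 : ℝ)) := by gcongr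
      _ ≤ 4 * (Cpol * ρ ^ (7 / 2 : ℝ) + Csw * ρ ^ (7 / 2 : ℝ)) :=
          mul_le_mul' le_rfl (add_le_add le_rfl (mul_le_mul' le_rfl
            (ENNReal.rpow_le_rpow_of_exponent_ge hρ1 (by norm_num : (7 / 2 : ℝ) ≤ 22 / 5))))
  -- `C(R) = (R²)⁻¹ ∫_{Q(R)} |v|³`
  show (ENNReal.ofReal R ^ 2)⁻¹ * ∫⁻ z in SereginSverak2009.parCyl 0 R, ‖v z.1 z.2‖ₑ ^ (3 : ℕ) ≤ _
  have hinv : (ρ ^ 2)⁻¹ * ρ ^ 2 = 1 := ENNReal.inv_mul_cancel (pow_ne_zero _ hρ0) (ENNReal.pow_ne_top hρt)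
  calc (ρ ^ 2)⁻¹ * ∫⁻ z in SereginSverak2009.parCyl 0 R, ‖v z.1 z.2‖ₑ ^ (3 : ℕ)
      ≤ (ρ ^ 2)⁻¹ * (4 * (Cpol * ρ ^ (7 / 2 : ℝ) + Csw * ρ ^ (7 / 2 : ℝ))) := mul_le_mul' le_rfl hI
    _ = 4 * (Cpol + Csw) * ρ ^ (3 / 2 : ℝ) := by
        rw [show (7 / 2 : ℝ) = 2 + 3 / 2 by norm_num, ENNReal.rpow_add _ _ hρ0 hρt,
          show ρ ^ (2 : ℝ) = ρ ^ (2 : ℕ) from ENNReal.rpow_ofNat ρ 2]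
        calc (ρ ^ 2)⁻¹ * (4 * (Cpol * (ρ ^ 2 * ρ ^ (3 / 2 : ℝ)) + Csw * (ρ ^ 2 * ρ ^ (3 / 2 : ℝ))))
            = (ρ ^ 2)⁻¹ * ρ ^ 2 * (4 * (Cpol + Csw) * ρ ^ (3 / 2 : ℝ)) := by ring
          _ = _ := by rw [hinv, one_mul]

end Main

section Wrappers

/-- **`C(R) → 0` from (2.7)** (Seregin 2022, §2 Step 4: "`→ 0` as `R → 0`" in (2.8) and in the last
display): under the hypotheses of `cubicC_le_of_twoSeven`,
`SereginSverak2009.cubicC 0 R v → 0` as `R → 0⁺` — the input of the landed endgame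
`isRegularAtOrigin_of_tendsto_cubicC`. [cite: Seregin2022LocalAxisym, §2 Step 4 (arXiv:2201.00153 p. 7)] -/
theorem tendsto_cubicC_of_twoSeven : ∀ (v : ℝ → EuclideanSpace ℝ (Fin 3) → EuclideanSpace ℝ (Fin 3)) (ζ : EuclideanSpace ℝ (Fin 3) → ℝ) (U : Set (EuclideanSpace ℝ (Fin 3))) (t₁ r₁ L : ℝ) (A KΓ KΦ KΦ' : ℝ≥0), t₁ < 0 → 0 < r₁ → r₁ ≤ 1 → AEStronglyMeasurable (uncurry v) (volume.restrict (SereginSverak2009.parCyl 0 r₁)) → (∀ t ∈ Ioo t₁ 0, ContDiff ℝ 4 (v t)) → (∀ t ∈ Ioo t₁ 0, IsAxisymmetric (v t)) → IsOpen U → (∀ t ∈ Ioo t₁ 0, ∀ x ∈ U, VectorCalculus.divergence (v t) x = 0) → ContDiff ℝ 2 ζ → tsupport ζ ⊆ U → tsupport ζ ⊆ SereginSverak2009.spaceCyl 0 1 → (∀ x ∈ SereginSverak2009.spaceCyl 0 r₁, ζ x = 1) → (∀ t ∈ Ioo t₁ 0, ∫⁻ x in SereginSverak2009.spaceCyl 0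 1, ‖v t x‖ₑ ^ 2 ≤ A) → (∀ t ∈ Ioo t₁ 0, ∀ x, fderiv ℝ ζ x ≠ 0 → ‖v t x‖ ≤ L) → (∀ t ∈ Ioo t₁ 0, ∫⁻ x, ‖ζ x * angVortQuot (v t) x‖ₑ ^ 2 ≤ KΓ) → (∀ t ∈ Ioo t₁ 0, ∫⁻ x, ‖ζ x * radVelQuot (curl (v t)) x‖ₑ ^ 2 ≤ KΦ) → (∫⁻ t in Ioo t₁ 0, ∫⁻ x, ‖fderiv ℝ (fun y => ζ y * radVelQuot (curl (v t)) y) x‖ₑ ^ 2 ≤ KΦ') → Tendsto (fun R => SereginSverak2009.cubicC 0 R v) (𝓝[>] 0) (𝓝 0) := by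
  intro v ζ U t₁ r₁ L A KΓ KΦ KΦ' ht₁ hr₁ hr₁1 hmeas hv hax hU hdiv hζ hζU hζ1 hζr₁ hA hLv hΓ hΦ hΦ'
  obtain ⟨C, hC⟩ := cubicC_le_of_twoSeven v ζ U t₁ r₁ L A KΓ KΦ KΦ' ht₁ hr₁ hr₁1 hmeas hv hax hU
    hdiv hζ hζU hζ1 hζr₁ hA hLv hΓ hΦ hΦ'
  exact tendsto_cubicC_of_le_rpow (lt_min hr₁ (Real.sqrt_pos.2 (by linarith))) (by norm_num) hC

/-- **Seregin 2022, §2 Step 4 from the printed Step-3 output: `C(R) ≤ C R^{3/2}`.** Same slab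
setting as `cubicC_le_of_twoSeven`, but with the Step-3 bounds as printed (arXiv p. 7, top):
`sup_{t} ∫ η⁶(|Γ|² + |Φ|²) ≤ K` and `∫_{t₁}^0 ∫ (η³|∇Φ|)² + (η³|∇Γ|)² ≤ K` (`η⁶ = ζ²`, the time
integral iterated), together with boundedness of `Φ = ω_r/r` on `supp ∇ζ` (Step 1: "`v`, `∇v`,
`∇²v`" and "`|∇ω|`" are bounded on `supp ∇η`, `|Φ| ≤ |∇ω|`), through the rewriting "to the form
(2.7)" (`lintegral_enorm_fderiv_mul_radVelQuot_sq_le`). [cite: Seregin2022LocalAxisym, §2 Step 3 (last display) and Step 4 (arXiv:2201.00153 p. 7)] -/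
theorem cubicC_le_of_step3Bounds : ∀ (v : ℝ → EuclideanSpace ℝ (Fin 3) → EuclideanSpace ℝ (Fin 3)) (ζ : EuclideanSpace ℝ (Fin 3) → ℝ) (U : Set (EuclideanSpace ℝ (Fin 3))) (t₁ r₁ L : ℝ) (A K : ℝ≥0), t₁ < 0 → 0 < r₁ → r₁ ≤ 1 → AEStronglyMeasurable (uncurry v) (volume.restrict (SereginSverak2009.parCyl 0 r₁)) → (∀ t ∈ Ioo t₁ 0, ContDiff ℝ 4 (v t)) → (∀ t ∈ Ioo t₁ 0, IsAxisymmetric (v t)) → IsOpen U → (∀ t ∈ Ioo t₁ 0, ∀ x ∈ U, VectorCalculus.divergence (v t) x = 0) → ContDiff ℝ 2 ζ → tsupport ζ ⊆ U → tsupport ζ ⊆ SereginSverak2009.spaceCyl 0 1 → (∀ x ∈ SereginSverak2009.spaceCyl 0 r₁, ζ x = 1) → (∀ t ∈ Ioo t₁ 0, ∫⁻ x in SereginSverak2009.spaceCyl 0 1, ‖v t x‖ₑ ^ 2 ≤ A) → (∀ t ∈ Ioo t₁ 0, ∀ x, fderiv ℝ ζ x ≠ 0 → ‖v t x‖ ≤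 L) → (∀ t ∈ Ioo t₁ 0, ∀ x, fderiv ℝ ζ x ≠ 0 → |radVelQuot (curl (v t)) x| ≤ L) → (∀ t ∈ Ioo t₁ 0, ∫⁻ x, ENNReal.ofReal (ζ x ^ 2 * (angVortQuot (v t) x ^ 2 + radVelQuot (curl (v t)) x ^ 2)) ≤ K) → (∫⁻ t in Ioo t₁ 0, ∫⁻ x, ENNReal.ofReal (ζ x ^ 2 * (‖fderiv ℝ (radVelQuot (curl (v t))) x‖ ^ 2 + ‖fderiv ℝ (angVortQuot (v t)) x‖ ^ 2)) ≤ K) → ∃ C : ℝ≥0, ∀ R ∈ Ioc 0 (min r₁ (Real.sqrt (-t₁))), SereginSverak2009.cubicC 0 R v ≤ C * ENNReal.ofReal R ^ (3 / 2 : ℝ) := by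
  intro v ζ U t₁ r₁ L A K ht₁ hr₁ hr₁1 hmeas hv hax hU hdiv hζ hζU hζ1 hζr₁ hA hLv hLΦ hK hK'
  have hζc : HasCompactSupport ζ := hasCompactSupport_of_tsupport_subset_spaceCyl hζ1
  obtain ⟨Cζ, hCζ⟩ :=
    (hζ.continuous_fderiv (by norm_num)).bounded_above_of_compact_support (hζc.fderiv ℝ)
  -- the `sup` terms of (2.7)
  have hΓ : ∀ t ∈ Ioo t₁ 0, ∫⁻ x, ‖ζ x * angVortQuot (v t) x‖ₑ ^ 2 ≤ K := fun t ht => by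
    refine (lintegral_mono fun x => ?_).trans (hK t ht)
    rw [Real.enorm_eq_ofReal_abs, ← ENNReal.ofReal_pow (abs_nonneg _), sq_abs, mul_pow]
    exact ENNReal.ofReal_le_ofReal (by
      nlinarith [mul_nonneg (sq_nonneg (ζ x)) (sq_nonneg (radVelQuot (curl (v t)) x))])
  have hΦ : ∀ t ∈ Ioo t₁ 0, ∫⁻ x, ‖ζ x * radVelQuot (curl (v t)) x‖ₑ ^ 2 ≤ K := fun t ht => by
    refine (lintegral_mono fun x => ?_).trans (hK t ht)
    rw [Real.enorm_eq_ofReal_abs, ← ENNReal.ofReal_pow (abs_nonneg _), sq_abs, mul_pow]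
    exact ENNReal.ofReal_le_ofReal (by
      nlinarith [mul_nonneg (sq_nonneg (ζ x)) (sq_nonneg (angVortQuot (v t) x))])
  -- the dissipation term of (2.7) for `Φ`
  set c' : ℝ≥0∞ := ENNReal.ofReal (2 * Cζ ^ 2 * L ^ 2) *
    volume (SereginSverak2009.spaceCyl (0 : EuclideanSpace ℝ (Fin 3)) 1) with hc'
  set D : ℝ → ℝ≥0∞ := fun t => ∫⁻ x, ENNReal.ofReal (ζ x ^ 2 *
    (‖fderiv ℝ (radVelQuot (curl (v t))) x‖ ^ 2 + ‖fderiv ℝ (angVortQuot (v t)) x‖ ^ 2)) with hD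
  have hV : volume (SereginSverak2009.spaceCyl (0 : EuclideanSpace ℝ (Fin 3)) 1) ≠ ∞ :=
    ((SereginSverak2009.volume_spaceCyl_le 0 one_pos).trans_lt
      (ENNReal.mul_lt_top ENNReal.ofReal_lt_top measure_ball_lt_top)).ne
  have hc't : c' ≠ ∞ := ENNReal.mul_ne_top ENNReal.ofReal_ne_top hV
  have hDK : ∫⁻ t in Ioo t₁ 0, ∫⁻ x, ‖fderiv ℝ (fun y => ζ y * radVelQuot (curl (v t)) y) x‖ₑ ^ 2 ≤
      2 * K + c' * ENNReal.ofReal (-t₁) := by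
    calc ∫⁻ t in Ioo t₁ 0, ∫⁻ x, ‖fderiv ℝ (fun y => ζ y * radVelQuot (curl (v t)) y) x‖ₑ ^ 2
        ≤ ∫⁻ t in Ioo t₁ 0, (2 * D t + c') := setLIntegral_mono' measurableSet_Ioo fun t ht =>
          lintegral_enorm_fderiv_mul_radVelQuot_sq_le (hv t ht) (hζ.of_le (by norm_num)) hζ1 hCζ
            (hLΦ t ht)
      _ = 2 * (∫⁻ t in Ioo t₁ 0, D t) + c' * volume (Ioo t₁ 0) := by
          rw [lintegral_add_right _ measurable_const, lintegral_const_mul' _ _ ENNReal.ofNat_ne_top,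
            lintegral_const, Measure.restrict_apply_univ]
      _ ≤ 2 * K + c' * ENNReal.ofReal (-t₁) := by
          rw [Real.volume_Ioo, zero_sub]
          gcongr
  have hfin : 2 * (K : ℝ≥0∞) + c' * ENNReal.ofReal (-t₁) ≠ ∞ :=
    ENNReal.add_ne_top.2 ⟨ENNReal.mul_ne_top ENNReal.ofNat_ne_top ENNReal.coe_ne_top,
      ENNReal.mul_ne_top hc't ENNReal.ofReal_ne_top⟩
  refine cubicC_le_of_twoSeven v ζ U t₁ r₁ L A K K (2 * (K : ℝ≥0∞) + c' * ENNReal.ofReal (-t₁)).toNNReal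
    ht₁ hr₁ hr₁1 hmeas hv hax hU hdiv hζ hζU hζ1 hζr₁ hA hLv hΓ hΦ ?_
  rwa [ENNReal.coe_toNNReal hfin]

/-- **Seregin 2022, §2 Step 4 from the printed Step-3 output: `C(R) → 0` as `R → 0⁺`** (the
hypothesis of the landed endgame `isRegularAtOrigin_of_tendsto_cubicC`), classical-on-a-slab form:
slices `v t ∈ C⁴(ℝ³)`, `t ∈ ]t₁, 0[`, axisymmetric and divergence free on an open `U`; a `C²`
cut-off `ζ = η³` with `tsupport ζ ⊆ U ∩ 𝒞`, `ζ = 1` on `𝒞(r₁)`; energy class `sup_t ∫_𝒞|v|² ≤ A`;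
`|v| ≤ L` and `|Φ| ≤ L` on `supp ∇ζ`; and the Step-3 bounds
`sup_t ∫ ζ²(Γ² + Φ²) ≤ K`, `∫_{t₁}^0∫ ζ²(‖∇Φ‖² + ‖∇Γ‖²) ≤ K` ⇒ `SereginSverak2009.cubicC 0 R v → 0`.
[cite: Seregin2022LocalAxisym, §2 Step 4 (arXiv:2201.00153 p. 7)] -/
theorem tendsto_cubicC_of_step3Bounds : ∀ (v : ℝ → EuclideanSpace ℝ (Fin 3) → EuclideanSpace ℝ (Fin 3)) (ζ : EuclideanSpace ℝ (Fin 3) → ℝ) (U : Set (EuclideanSpace ℝ (Fin 3))) (t₁ r₁ L : ℝ) (A K : ℝ≥0), t₁ < 0 → 0 < r₁ → r₁ ≤ 1 → AEStronglyMeasurable (uncurry v) (volume.restrict (SereginSverak2009.parCyl 0 r₁)) → (∀ t ∈ Ioo t₁ 0, ContDiff ℝ 4 (v t)) → (∀ t ∈ Ioo t₁ 0, IsAxisymmetric (v t)) → IsOpen U → (∀ t ∈ Ioo t₁ 0, ∀ x ∈ U, VectorCalculus.divergence (v t) x = 0) → ContDiff ℝ 2 ζ → tsupport ζ ⊆ U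 → tsupport ζ ⊆ SereginSverak2009.spaceCyl 0 1 → (∀ x ∈ SereginSverak2009.spaceCyl 0 r₁, ζ x = 1) → (∀ t ∈ Ioo t₁ 0, ∫⁻ x in SereginSverak2009.spaceCyl 0 1, ‖v t x‖ₑ ^ 2 ≤ A) → (∀ t ∈ Ioo t₁ 0, ∀ x, fderiv ℝ ζ x ≠ 0 → ‖v t x‖ ≤ L) → (∀ t ∈ Ioo t₁ 0, ∀ x, fderiv ℝ ζ x ≠ 0 → |radVelQuot (curl (v t)) x| ≤ L) → (∀ t ∈ Ioo t₁ 0, ∫⁻ x, ENNReal.ofReal (ζ x ^ 2 * (angVortQuot (v t) x ^ 2 + radVelQuot (curl (v t)) x ^ 2)) ≤ K) → (∫⁻ t in Ioo t₁ 0, ∫⁻ x, ENNReal.ofReal (ζ x ^ 2 * (‖fderiv ℝ (radVelQuot (curl (v t))) x‖ ^ 2 + ‖fderiv ℝ (angVortQuot (v t)) x‖ ^ 2)) ≤ K) → Tendsto (fun R => SereginSverak2009.cubicC 0 R v) (𝓝[>] 0) (𝓝 0) := by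
  intro v ζ U t₁ r₁ L A K ht₁ hr₁ hr₁1 hmeas hv hax hU hdiv hζ hζU hζ1 hζr₁ hA hLv hLΦ hK hK'
  obtain ⟨C, hC⟩ := cubicC_le_of_step3Bounds v ζ U t₁ r₁ L A K ht₁ hr₁ hr₁1 hmeas hv hax hU hdiv hζ
    hζU hζ1 hζr₁ hA hLv hLΦ hK hK'
  exact tendsto_cubicC_of_le_rpow (lt_min hr₁ (Real.sqrt_pos.2 (by linarith))) (by norm_num) hC

/-- **Seregin 2022, §2 Steps 3–4 glued to the landed endgame**: for a suitable weak solution of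
Def. 1.1 in `Q = 𝒞 × ]-1, 0[` (the hypothesis block of `seregin2022_logSwirl_regularAtOrigin`) whose
velocity is, on a final slab `]t₁, 0[`, classical in the sense of `tendsto_cubicC_of_step3Bounds`
and obeys the Step-3 bounds there, the origin is a regular point
(`isRegularAtOrigin_of_tendsto_cubicC`). [cite: Seregin2022LocalAxisym, §2 Step 4, last paragraph (arXiv:2201.00153 p. 7)] -/
theorem isRegularAtOrigin_of_step3Bounds
    {v : ℝ → EuclideanSpace ℝ (Fin 3) → EuclideanSpace ℝ (Fin 3)} {q : ℝ → EuclideanSpace ℝ (Fin 3) → ℝ}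
    (hsw : IsSuitableWeakSolutionOn (SereginSverak2009.parCylOpens 0 1) 1 0 v q)
    (hA₀ : ∃ C : ℝ≥0, ∀ᵐ t ∂(volume.restrict (Ioo (-1 : ℝ) 0)),
      ∫⁻ x in SereginSverak2009.spaceCyl 0 1, ‖v t x‖ₑ ^ 2 ≤ C)
    (hG : ∃ G : ℝ → EuclideanSpace ℝ (Fin 3) → EuclideanSpace ℝ (Fin 3) →L[ℝ] EuclideanSpace ℝ (Fin 3),
      HasWeakSpatialGradientOn (SereginSverak2009.parCylOpens 0 1) v G ∧
      ∫⁻ z in SereginSverak2009.parCyl 0 1, ENNReal.ofReal (frobeniusNormSq (G z.1 z.2)) < ∞)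
    (hq : ∫⁻ z in SereginSverak2009.parCyl 0 1, ‖q z.1 z.2‖ₑ ^ (3 / 2 : ℝ) < ∞)
    {ζ : EuclideanSpace ℝ (Fin 3) → ℝ} {U : Set (EuclideanSpace ℝ (Fin 3))} {t₁ r₁ L : ℝ} {A K : ℝ≥0}
    (ht₁ : t₁ < 0) (hr₁ : 0 < r₁) (hr₁1 : r₁ ≤ 1)
    (hv : ∀ t ∈ Ioo t₁ 0, ContDiff ℝ 4 (v t)) (hax : ∀ t ∈ Ioo t₁ 0, IsAxisymmetric (v t))
    (hU : IsOpen U) (hdiv : ∀ t ∈ Ioo t₁ 0, ∀ x ∈ U, VectorCalculus.divergence (v t) x = 0)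
    (hζ : ContDiff ℝ 2 ζ) (hζU : tsupport ζ ⊆ U) (hζ1 : tsupport ζ ⊆ SereginSverak2009.spaceCyl 0 1)
    (hζr₁ : ∀ x ∈ SereginSverak2009.spaceCyl 0 r₁, ζ x = 1)
    (hA : ∀ t ∈ Ioo t₁ 0, ∫⁻ x in SereginSverak2009.spaceCyl 0 1, ‖v t x‖ₑ ^ 2 ≤ A)
    (hLv : ∀ t ∈ Ioo t₁ 0, ∀ x, fderiv ℝ ζ x ≠ 0 → ‖v t x‖ ≤ L)
    (hLΦ : ∀ t ∈ Ioo t₁ 0, ∀ x, fderiv ℝ ζ x ≠ 0 → |radVelQuot (curl (v t)) x| ≤ L)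
    (hK : ∀ t ∈ Ioo t₁ 0, ∫⁻ x, ENNReal.ofReal (ζ x ^ 2 *
      (angVortQuot (v t) x ^ 2 + radVelQuot (curl (v t)) x ^ 2)) ≤ K)
    (hK' : ∫⁻ t in Ioo t₁ 0, ∫⁻ x, ENNReal.ofReal (ζ x ^ 2 *
      (‖fderiv ℝ (radVelQuot (curl (v t))) x‖ ^ 2 + ‖fderiv ℝ (angVortQuot (v t)) x‖ ^ 2)) ≤ K) :
    SereginSverak2009.IsRegularAtOrigin v := by
  have hmeas : AEStronglyMeasurable (uncurry v) (volume.restrict (SereginSverak2009.parCyl 0 r₁)) :=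
    hsw.distributional.1.aestronglyMeasurable.mono_measure
      (Measure.restrict_mono ((SereginSverak2009.parCyl_mono 0 hr₁.le hr₁1).trans
        (subset_of_eq (SereginSverak2009.coe_parCylOpens 0 1).symm)) le_rfl)
  exact isRegularAtOrigin_of_tendsto_cubicC v q hsw hA₀ hG hq (tendsto_cubicC_of_step3Bounds v ζ U
    t₁ r₁ L A K ht₁ hr₁ hr₁1 hmeas hv hax hU hdiv hζ hζU hζ1 hζr₁ hA hLv hLΦ hK hK')

end Wrappers

section Bridge

/-- **`‖Df(x)‖² = (∂₀f)² + (∂₁f)² + (∂₂f)²` for a scalar `f` on `ℝ³`** (Riesz: `‖Df‖ = ‖∇f‖`, and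
`norm_gradient_sq`): the bridge between the operator-norm form `‖∇(ζΦ)‖²` of (2.7) used here and the
coordinate form of the Step-3 files. [folklore] -/
theorem norm_fderiv_sq_eq_sum_sq (f : EuclideanSpace ℝ (Fin 3) → ℝ) (x : EuclideanSpace ℝ (Fin 3)) :
    ‖fderiv ℝ f x‖ ^ 2 = fderiv ℝ f x (EuclideanSpace.single 0 1) ^ 2 +
      fderiv ℝ f x (EuclideanSpace.single 1 1) ^ 2 + fderiv ℝ f x (EuclideanSpace.single 2 1) ^ 2 := by
  rw [← norm_gradient_sq, gradient, LinearIsometryEquiv.norm_map]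

end Bridge

end Summit.NavierStokesRegularity.NavierStokesRegularity.Theorems.AxisymmetricKatoGlobal.EulerScaling

end
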